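import Literature.Probability.LatticeModels.PlaneRotatorBoxIsingComparison
import Literature.Probability.LatticeModels.TorusRowPairDecay
import Literature.Probability.LatticeModels.IsingTorusTransferProofs
import Literature.Probability.LatticeModels.OnsagerYangProofs
import Literature.Probability.LatticeModels.BoxTwoPointTransfer
import Literature.Probability.LatticeModels.TwistCorr
import HarnessLib

/-!
# The Onsager window of the plane rotator: Lieb's box number is `< 1` for every `K < log(1+√2)`, by
# Aizenman–Simon and the exact solution of the two-dimensional Ising model

Topic `Literature/Probability/LatticeModels`, namespace `Literature.Probability.LatticeModels` (rotator-side
declarations under `PlaneRotator`). M. Aizenman, B. Simon, *A comparison of plane rotor and Ising models*,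
Phys. Lett. **76A** (1980) 281–282 [AizenmanSimon1980RotorIsing]: eq. (1) `⟨s⃗_α·s⃗_γ⟩_{2β, rotor} ≤ ⟨σ_ασ_γ⟩_{β, Ising}`
(a KERNEL theorem of the tree, `PlaneRotator.AizenmanSimonRotorIsingComparison_holds`) and its consequence eq. (2)
«`β_c^R ≥ 2β_c^I` … in `d = 2`, using Onsager's value `β_c^I = ½ln(1+√2)`, `β_c^R ≥ ln(1+√2) = 0.88`, i.e.
`k T_c^R / J ≤ 1.13`» for the critical points defined by the loss of exponential clustering. E. H. Lieb,
Comm. Math. Phys. **77** (1980) 127 [Lieb1980], Theorem 4 and p. 128: the box criterion `S_R < 1` (tree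
`PlaneRotator.twoPoint_le_pow_boxShellSum`, `nnBoxShellSum`; torus form `torusXY_expectJ_cosDiff_le_pow_nnBoxShellSum`),
whose header lists as «Not here: … the converse ("`β < β_c ⇒ S_R < 1` for large `R`", which needs the a-priori decay
of the infinite-volume state)».

THIS FILE SUPPLIES THAT CONVERSE ON THE SQUARE LATTICE, WITH NO HYPOTHESIS AND NO NUMERICS, for every
`0 ≤ K < log(1+√2) = 2β_c(2)`: the a-priori decay is taken from the ISING side, where the tree holds the exact
solution — exponential decay of the free two-point function of the nearest-neighbour Ising model on `ℤ²` for every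
`0 < β < β_c(2) = ½log(1+√2)` is a theorem of the tree (`twoPointFree_row_exp_decay_of_exactSolution` on
`tendsto_torusRowPair_exists_holds` (transfer matrix, BGJS (3.3)) and `torusRowPairLimit_exp_decay_of_lt_criticalBetaTwo_holds`
(T. T. Wu 1966, decay of the Toeplitz determinants of Onsager's symbol above `T_c`), all directions by
`twoPointFree_exp_decay_of_row` (Messager–Miracle-Solé); standard axioms, no named fact).

* §1 `twoPointFree_two_exp_decay_of_lt_criticalBetaTwo` — the Ising input packaged: `0 < β < β_c(2)` ⇒
  `∃ C, c > 0, ∀ x ∈ ℤ², ⟨σ₀σ_x⟩^∅_β ≤ C e^{−c‖x‖_∞}`.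
* §2 `PairIsing.avg_spinPair_mono` (Griffiths' comparison of couplings for the pair-interaction average) and
  `PairIsing.avg_spinPair_le_twoPointFree` — a pair-interaction Ising two-point function on a finite `Λ ⊂ ℤ^d` with
  couplings dominated by `β/2 · 𝟙{x ∼ y}` (i.e. inverse temperature `β` per bond) is at most the infinite-volume free
  two-point function `⟨σ₀σ_{b−a}⟩^∅_β` (GKS II in the couplings and in the volume).
* §3 `PlaneRotator.isingBoxShellSum_nn_le_sum_twoPointFree` (any `d`) and, for `d = 2`,
  `PlaneRotator.nnBoxShellSum_two_le_card_mul_exp`: `S_R(K) ≤ (2R+1)²·C·e^{−cR}` for `0 ≤ K ≤ K'`, `0 < K' < log(1+√2)`,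
  with the constants of §1 at `β = K'/2`.
* §4 **`PlaneRotator.exists_nnBoxShellSum_lt_one_of_lt_log_one_add_sqrt_two`** — for every `0 ≤ K < log(1+√2)`
  there is `R ≥ 1` with `S_R(K) = nnBoxShellSum K 2 R < 1`: Lieb's finite algorithm TERMINATES throughout the
  Aizenman–Simon–Onsager window.
* §5 **`PlaneRotator.twoPoint_nn_exp_decay_of_lt_log_one_add_sqrt_two`** — Aizenman–Simon eq. (2) as a kernel
  theorem: for `0 ≤ K < log(1+√2)` the nearest-neighbour XY two-point function decays exponentially,
  `⟨cos(θ_a − θ_c)⟩_{Λ,K} ≤ C e^{−c‖a−c‖_∞}`, UNIFORMLY over all finite `Λ ⊂ ℤ²` (free boundary conditions).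
* §6 the decimal `1/log(1+√2) < 1.1346` (`inv_log_one_add_sqrt_two_lt`), i.e. `k T_c/J ≤ 1.1346` in eq. (2).

Cell use (`pub/hubbard-tc`, MO-S3, crux №2 classical side): with the torus engine
(`PlaneRotatorStiffnessTwoPointBound`, `PlaneRotatorTorusBoxCriterion`) §4 gives `βΥ_L(K) → 0` for every
`K < log(1+√2) = 0.8814`, so the classical XY comparison model has no stiffness above `T = J/log(1+√2) = 1.1346·J`
as a theorem WITHOUT the universal-jump input (sibling file `PlaneRotatorOnsagerWindowStiffness.lean`).

## What this is not

A statement about the classical comparison model (plane rotator) and the classical Ising model only; nothing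
electronic, no `T_c` of a material; the universal-jump relation (K2) is neither used nor proved. The window is
Aizenman–Simon's `log(1+√2) = 0.8814 < K_c^{XY} ≈ 1.12` [float], not the Kosterlitz–Thouless point.
-/

noncomputable section

open MeasureTheory Finset Filter Topology
open scoped BigOperators

namespace Literature.Probability.LatticeModels

open Literature.Barriers.CriticalPhenomena Literature.Barriers.CriticalPhenomena.LongRangeIsing

/-! ## §1 The Ising input: exponential decay on `ℤ²` below `β_c(2)`, from the exact solution -/

/-- **Exponential clustering of the planar Ising model below `β_c(2) = ½log(1+√2)`, unconditionally** (the
exact solution: T. T. Wu 1966 above `T_c` for the row correlations, via the tree's Toeplitz chain; GKS sandwich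
free ≤ periodic, BGJS (3.7); Messager–Miracle-Solé for all directions): for `0 < β < β_c(2)` there are `C > 0`
and `c > 0` with `⟨σ₀σ_x⟩^∅_{β} ≤ C e^{−c‖x‖_∞}` for every `x ∈ ℤ²`.
[cite: Wu1966, T > T_c asymptotics of the in-row correlation (= DeiftItsKrasovsky2013, §5, eq. (64))]
[cite: MessagerMiracleSoleJSP1977, main theorem] -/
theorem twoPointFree_two_exp_decay_of_lt_criticalBetaTwo {β : ℝ} (hβ0 : 0 < β) (hβ : β < criticalBetaTwo) :
    ∃ C c : ℝ, 0 < C ∧ 0 < c ∧ ∀ x : Site 2, twoPointFree 2 β x ≤ C * Real.exp (-c * ‖x‖) := by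
  obtain ⟨C, c, hc, hrow⟩ := twoPointFree_row_exp_decay_of_exactSolution tendsto_torusRowPair_exists_holds
    torusRowPairLimit_exp_decay_of_lt_criticalBetaTwo_holds hβ0 hβ
  exact ⟨max C 1, c, lt_max_of_lt_right one_pos, hc, twoPointFree_exp_decay_of_row hβ0.le hrow⟩

/-- `log(1+√2) = 2·β_c(2)`. [cite: AizenmanSimon1980RotorIsing, eq. (2)] -/
theorem log_one_add_sqrt_two_eq_two_mul_criticalBetaTwo :
    Real.log (1 + Real.sqrt 2) = 2 * criticalBetaTwo := by
  unfold criticalBetaTwo; ring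

/- `0 < log(1+√2)` is the landed `Literature.Analysis.Matrix.log_one_add_sqrt_two_pos`
(`GrothendieckInequality.lean`); below it is re-derived inline from `criticalBetaTwo_pos` to keep the import
list inside `LatticeModels`. -/

/-! ## §2 Pair-interaction Ising two-point functions below the nearest-neighbour ones, and below `⟨σσ⟩^∅` -/

namespace PairIsing

variable {ι : Type*} [Fintype ι] [DecidableEq ι]

/-- **Griffiths' comparison of couplings for the pair-interaction average**: `|c'| ≤ c` entrywise ⇒
`⟨σ_aσ_b⟩_{c'} ≤ ⟨σ_aσ_b⟩_c` (through `avg_eq_gksExpect` and `gksExpect_mono_of_abs_le`).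
[cite: FriedliVelenik2017, Exercise 3.31, p. 142] -/
theorem avg_spinPair_mono {c c' : ι → ι → ℝ} (h : ∀ x y, |c' x y| ≤ c x y) (a b : ι) :
    avg c' (spinPair a b) ≤ avg c (spinPair a b) := by
  classical
  by_cases hab : a = b
  · subst hab
    rw [spinPair_self, avg_const, avg_const]
  · rw [spinPair_eq_spinProduct hab, avg_eq_gksExpect, avg_eq_gksExpect]
    exact gksExpect_mono_of_abs_le _ _ (fun p _ => h p.1 p.2) _

/-- **A pair-interaction Ising model on a finite `Λ ⊂ ℤ^d` whose couplings are dominated by the nearest-neighbour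
ones at inverse temperature `β` has two-point functions below the infinite-volume free two-point function**:
if `|c(x,y)| ≤ β/2 · 𝟙{x ∼ y}` (ordered pairs; `β ≥ 0`) then `⟨σ_aσ_b⟩_c ≤ ⟨σ₀σ_{b−a}⟩^∅_{β}` — Griffiths in the
couplings (`avg_spinPair_mono`), the identification with the graph Ising model (`avg_adj_eq_isingExpect_free`),
and Griffiths in the volume (`isingTwoPoint_box_le_twoPointFree`).
[cite: FriedliVelenik2017, Exercise 3.12 and Exercise 3.31] -/
theorem avg_spinPair_le_twoPointFree {d : ℕ} {β : ℝ} (hβ : 0 ≤ β) (Λ : Finset (Site d)) {c : Λ → Λ → ℝ}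
    (hc : ∀ x y : Λ, |c x y| ≤ if (zdGraph d).Adj (x : Site d) y then β / 2 else 0) (a b : Λ) :
    avg c (spinPair a b) ≤ twoPointFree d β ((b : Site d) - a) := by
  classical
  refine (avg_spinPair_mono hc a b).trans ?_
  rw [avg_adj_eq_isingExpect_free (zdGraph d) Λ β (spinPair a b)]
  exact isingTwoPoint_box_le_twoPointFree hβ a.2 b.2

end PairIsing

/-! ## §3 Lieb's number below the shell sum of the infinite-volume Ising two-point function -/

namespace PlaneRotator

variable {d : ℕ}

omit d in
/-- Membership in the reference shell: `‖b‖_∞ = R`. [cite: Lieb1980, p. 128 (B the boundary of a box)] -/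
private theorem mem_refShell_iff {d R : ℕ} {b : box d R} : b ∈ refShell d R ↔ Site.supNorm (b : Site d) = R := by
  simp [refShell]

omit d in
/-- Nearest neighbours of `ℤ^d`: `nnCoupling d x y = 𝟙{x ∼ y}` for the graph `zdGraph d`. [folklore] -/
private theorem nnCoupling_eq_ite_adj {d : ℕ} (x y : Site d) :
    nnCoupling d x y = if (zdGraph d).Adj x y then 1 else 0 := by
  have hadj : (zdGraph d).Adj x y ↔ l1Norm (x - y) = 1 := by
    rw [zdGraph_adj_iff_norm_holds x y]
    have h : ((l1Norm (x - y) : ℕ) : ℤ) = ∑ i, |x i - y i| := by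
      simp only [l1Norm, Nat.cast_sum, Int.natCast_natAbs, Pi.sub_apply]
    rw [← h]
    norm_cast
  unfold nnCoupling
  simp only [hadj]

omit d in
/-- The reference inside couplings `K/4 · 𝟙{x ∼ y}` (shell–shell bonds removed) are dominated by the nearest-neighbour
Ising couplings at inverse temperature `K'/2` whenever `0 ≤ K ≤ K'`. [cite: Lieb1980, eqs. (4)–(5) (H_C ≤ H)] -/
private theorem abs_refCoupling_nn_le {d : ℕ} {K K' : ℝ} (hK : 0 ≤ K) (hKK' : K ≤ K') (R : ℕ) (x y : box d R) :
    |refCoupling (fun x y : Site d => K / 4 * nnCoupling d x y) R (x, y)| ≤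
      if (zdGraph d).Adj (x : Site d) y then K' / 2 / 2 else 0 := by
  unfold refCoupling
  dsimp only
  rw [nnCoupling_eq_ite_adj]
  split_ifs <;> simp only [abs_zero, mul_one, mul_zero, le_refl] <;>
    (try rw [abs_of_nonneg (by linarith)]) <;> linarith

/-- **The Ising box number is at most the shell sum of the infinite-volume free two-point function** (any `d`):
for `0 ≤ K ≤ K'`, `S_R^{Ising}(K/4 · 𝟙_{nn}) ≤ ∑_{‖b‖_∞ = R} ⟨σ₀σ_b⟩^∅_{K'/2}` — the Ising number of Lieb's
algorithm at coupling `K/2` per bond (Aizenman–Simon's `β` for the rotator's `2β = K`) against the free state of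
`ℤ^d` at `β = K'/2`. [cite: Lieb1980, Theorem 4 and p. 128 (boxes); FriedliVelenik2017, Exercise 3.12] -/
theorem isingBoxShellSum_nn_le_sum_twoPointFree {K K' : ℝ} (hK : 0 ≤ K) (hKK' : K ≤ K') (R : ℕ) :
    isingBoxShellSum (fun x y : Site d => K / 4 * nnCoupling d x y) R ≤
      ∑ b ∈ refShell d R, twoPointFree d (K' / 2) (b : Site d) := by
  classical
  unfold isingBoxShellSum
  refine Finset.sum_le_sum fun b _ => ?_
  have h := PairIsing.avg_spinPair_le_twoPointFree (d := d) (β := K' / 2) (by linarith) (box d R)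
    (c := fun x y : box d R => refCoupling (fun x y : Site d => K / 4 * nnCoupling d x y) R (x, y))
    (fun x y => abs_refCoupling_nn_le hK hKK' R x y) (refCentre d R) b
  simpa [refCentre] using h

variable [MeasurableSpace Circle] [BorelSpace Circle]

/-- **Lieb's number for the square lattice inside the Onsager window**: if `0 ≤ K ≤ K'` and the free Ising two-point
function of `ℤ²` at `β = K'/2` obeys `⟨σ₀σ_x⟩^∅ ≤ C e^{−c‖x‖_∞}`, then
`S_R(K) = nnBoxShellSum K 2 R ≤ (2R+1)² · C · e^{−cR}` (Aizenman–Simon on the box, shell–shell bonds removed, then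
§2 and the shell has at most `(2R+1)²` sites). [cite: AizenmanSimon1980RotorIsing, eq. (1); Lieb1980, Theorem 4 and p. 128 (boxes)] -/
theorem nnBoxShellSum_two_le_card_mul_exp {K K' C c : ℝ} (hK : 0 ≤ K) (hKK' : K ≤ K') (hC : 0 ≤ C)
    (hdec : ∀ x : Site 2, twoPointFree 2 (K' / 2) x ≤ C * Real.exp (-c * ‖x‖)) (R : ℕ) :
    nnBoxShellSum K 2 R ≤ (2 * R + 1) ^ 2 * C * Real.exp (-c * R) := by
  classical
  have hJf0 : ∀ x y : Site 2, 0 ≤ K / 2 * nnCoupling 2 x y :=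
    fun x y => mul_nonneg (by positivity) (nnCoupling_nonneg _ _)
  have h1 := boxShellSum_le_isingBoxShellSum hJf0 R
  have hhalf : (fun x y : Site 2 => K / 2 * nnCoupling 2 x y / 2) = fun x y => K / 4 * nnCoupling 2 x y := by
    funext x y; ring
  rw [hhalf] at h1
  have h2 := isingBoxShellSum_nn_le_sum_twoPointFree (d := 2) hK hKK' R
  -- each shell term is at most `C e^{-cR}`
  have h3 : ∑ b ∈ refShell 2 R, twoPointFree 2 (K' / 2) (b : Site 2) ≤
      ∑ _b ∈ refShell 2 R, C * Real.exp (-c * R) := by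
    refine Finset.sum_le_sum fun b hb => ?_
    have hnorm : ‖(b : Site 2)‖ = (R : ℝ) := by
      rw [Site.norm_eq_supNorm, mem_refShell_iff.1 hb]
    have := hdec (b : Site 2)
    rwa [hnorm] at this
  have h4 : (∑ _b ∈ refShell 2 R, C * Real.exp (-c * R)) ≤ (2 * R + 1) ^ 2 * C * Real.exp (-c * R) := by
    rw [Finset.sum_const, nsmul_eq_mul, ← mul_assoc]
    refine mul_le_mul_of_nonneg_right (mul_le_mul_of_nonneg_right ?_ hC) (Real.exp_nonneg _)
    have hcard : (refShell 2 R).card ≤ (2 * R + 1) ^ 2 := by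
      calc (refShell 2 R).card ≤ Fintype.card (box 2 R) := Finset.card_le_univ _
        _ = (2 * R + 1) ^ 2 := by rw [Fintype.card_coe, card_box]
    exact_mod_cast hcard
  unfold nnBoxShellSum
  exact h1.trans (h2.trans (h3.trans h4))

/-! ## §4 The converse of the box criterion on `ℤ²`: `S_R(K) < 1` for some `R`, for every `K < log(1+√2)` -/

/-- **Lieb's finite algorithm terminates throughout the Aizenman–Simon–Onsager window.** For every
`0 ≤ K < log(1+√2) = 2β_c(2) ≈ 0.8814` there is a box radius `R ≥ 1` with
`S_R(K) = nnBoxShellSum K 2 R < 1` — the converse half of Lieb's box criterion for the nearest-neighbour plane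
rotator on the square lattice, with the a-priori decay supplied by the ISING model at half the coupling
(Aizenman–Simon eq. (1)) where it is the exact solution (Wu 1966, in the tree): `S_R(K) ≤ (2R+1)²·C·e^{−cR} → 0`.
No hypothesis, no numerics. [cite: AizenmanSimon1980RotorIsing, eqs. (1)–(2); Lieb1980, Theorem 4 and p. 128 (boxes: "one can, in principle, compute β_c to arbitrary accuracy")] -/
theorem exists_nnBoxShellSum_lt_one_of_lt_log_one_add_sqrt_two {K : ℝ} (hK0 : 0 ≤ K)
    (hK : K < Real.log (1 + Real.sqrt 2)) :
    ∃ R : ℕ, 1 ≤ R ∧ nnBoxShellSum K 2 R < 1 := by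
  -- an interior coupling `K < K' < log(1+√2)`, so that `β' = K'/2 ∈ (0, β_c(2))`
  set K' : ℝ := (K + Real.log (1 + Real.sqrt 2)) / 2 with hK'
  have hKK' : K ≤ K' := by rw [hK']; linarith
  have hlogpos : 0 < Real.log (1 + Real.sqrt 2) := by
    rw [log_one_add_sqrt_two_eq_two_mul_criticalBetaTwo]; exact mul_pos two_pos criticalBetaTwo_pos
  have hK'pos : 0 < K' / 2 := by rw [hK']; linarith
  have hK'lt : K' / 2 < criticalBetaTwo := by
    rw [hK']
    have := log_one_add_sqrt_two_eq_two_mul_criticalBetaTwo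
    linarith
  obtain ⟨C, c, hC, hc, hdec⟩ := twoPointFree_two_exp_decay_of_lt_criticalBetaTwo hK'pos hK'lt
  -- the majorant `(2R+1)² C e^{-cR} = C (4R² + 4R + 1) r^R`, `r = e^{-c} < 1`, tends to `0`
  set r : ℝ := Real.exp (-c) with hr
  have hr0 : 0 < r := Real.exp_pos _
  have hr1 : r < 1 := Real.exp_lt_one_iff.2 (by linarith)
  have hrabs : |r| < 1 := by rw [abs_of_pos hr0]; exact hr1
  have hexp : ∀ R : ℕ, Real.exp (-c * R) = r ^ R := fun R => by
    rw [hr, ← Real.exp_nat_mul]; ring_nf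
  have hlim : Tendsto (fun R : ℕ => (2 * (R : ℝ) + 1) ^ 2 * C * Real.exp (-c * R)) atTop (𝓝 0) := by
    have h2 := tendsto_pow_const_mul_const_pow_of_abs_lt_one 2 hrabs
    have h1 := tendsto_pow_const_mul_const_pow_of_abs_lt_one 1 hrabs
    have h0 := tendsto_pow_const_mul_const_pow_of_abs_lt_one 0 hrabs
    have hsum := ((h2.const_mul (4 * C)).add (h1.const_mul (4 * C))).add (h0.const_mul C)
    simp only [mul_zero, add_zero] at hsum
    refine hsum.congr fun R => ?_
    rw [hexp R]
    ring
  have hev : ∀ᶠ R : ℕ in atTop, (2 * (R : ℝ) + 1) ^ 2 * C * Real.exp (-c * R) < 1 :=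
    hlim.eventually (gt_mem_nhds one_pos)
  obtain ⟨R, hR1, hRlt⟩ := ((eventually_ge_atTop 1).and hev).exists
  exact ⟨R, hR1, (nnBoxShellSum_two_le_card_mul_exp hK0 hKK' hC.le hdec R).trans_lt hRlt⟩

/-! ## §5 Aizenman–Simon eq. (2): uniform exponential decay of the XY two-point function for `K < log(1+√2)` -/

/-- **Aizenman–Simon 1980, eq. (2), as a theorem on every finite volume**: for `0 ≤ K < log(1+√2)` there are
`C > 0`, `c > 0` such that for EVERY finite `Λ ⊂ ℤ²` (free boundary conditions) and all `a, b ∈ Λ`,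
`⟨cos(θ_a − θ_b)⟩_{Λ,K} ≤ C e^{−c‖b − a‖_∞}` — the nearest-neighbour plane rotator clusters exponentially,
uniformly in the volume, throughout the window `K < 2β_c^{Ising}(2) = log(1+√2)` («`β_c^R ≥ 2β_c^I`»): eq. (1) on
`Λ` (kernel theorem `AizenmanSimonRotorIsingComparison_holds`), Griffiths in couplings and volume (§2), and the
exact solution on the Ising side (§1) at `β = K'/2`, `K' = (K + log(1+√2))/2`.
[cite: AizenmanSimon1980RotorIsing, eqs. (1)–(2)] -/
theorem twoPoint_nn_exp_decay_of_lt_log_one_add_sqrt_two {K : ℝ} (hK0 : 0 ≤ K)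
    (hK : K < Real.log (1 + Real.sqrt 2)) :
    ∃ C c : ℝ, 0 < C ∧ 0 < c ∧ ∀ (Λ : Finset (Site 2)) (a b : Λ),
      twoPoint (nnXYCoupling K 2 Λ) a b ≤ C * Real.exp (-c * ‖(b : Site 2) - a‖) := by
  classical
  set K' : ℝ := (K + Real.log (1 + Real.sqrt 2)) / 2 with hK'
  have hKK' : K ≤ K' := by rw [hK']; linarith
  have hlogpos : 0 < Real.log (1 + Real.sqrt 2) := by
    rw [log_one_add_sqrt_two_eq_two_mul_criticalBetaTwo]; exact mul_pos two_pos criticalBetaTwo_pos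
  have hK'pos : 0 < K' / 2 := by rw [hK']; linarith
  have hK'lt : K' / 2 < criticalBetaTwo := by
    rw [hK']
    have := log_one_add_sqrt_two_eq_two_mul_criticalBetaTwo
    linarith
  obtain ⟨C, c, hC, hc, hdec⟩ := twoPointFree_two_exp_decay_of_lt_criticalBetaTwo hK'pos hK'lt
  refine ⟨C, c, hC, hc, fun Λ a b => ?_⟩
  -- Aizenman–Simon on `Λ` with `c(x,y) = K/4 · 𝟙{x ∼ y}` (`2c` = the XY couplings `K/2` per ordered pair)
  set cpl : Λ → Λ → ℝ := fun x y => K / 4 * nnCoupling 2 (x : Site 2) y with hcpl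
  have hcpl0 : ∀ x y, 0 ≤ cpl x y := fun x y => mul_nonneg (by positivity) (nnCoupling_nonneg _ _)
  have hAS := AizenmanSimonRotorIsingComparison_holds Λ cpl hcpl0 a b
  have h2c : (fun p : Λ × Λ => 2 * cpl p.1 p.2) = nnXYCoupling K 2 Λ := by
    funext p; simp only [hcpl, nnXYCoupling]; ring
  rw [h2c] at hAS
  refine hAS.trans ((PairIsing.avg_spinPair_le_twoPointFree (β := K' / 2) hK'pos.le Λ
    (fun x y => ?_) a b).trans (hdec _))
  -- `|K/4 · 𝟙{x ∼ y}| ≤ (K'/2)/2 · 𝟙{x ∼ y}`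
  simp only [hcpl, nnCoupling_eq_ite_adj]
  split_ifs
  · rw [mul_one, abs_of_nonneg (by positivity)]; linarith
  · rw [mul_zero, abs_zero]

/-! ## §6 The decimal: `1/log(1+√2) < 1.1346` -/

omit [MeasurableSpace Circle] [BorelSpace Circle] in
/-- `e^{0.88137} < 1 + √2` (Taylor remainder for `exp` at order `10` and `1.4142135² < 2`). [folklore] -/
private theorem exp_88137_lt_one_add_sqrt_two : Real.exp (88137 / 100000) < 1 + Real.sqrt 2 := by
  have hx : |(88137 / 100000 : ℝ)| ≤ 1 := by rw [abs_of_nonneg (by norm_num)]; norm_num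
  have hb := Real.exp_bound hx (n := 10) (by norm_num)
  have hsqrt : (14142135 / 10000000 : ℝ) < Real.sqrt 2 := by
    rw [Real.lt_sqrt (by norm_num)]; norm_num
  have hsum : (∑ m ∈ Finset.range 10, (88137 / 100000 : ℝ) ^ m / m.factorial) +
      |(88137 / 100000 : ℝ)| ^ 10 * ((Nat.succ 10 : ℕ) / ((Nat.factorial 10 : ℕ) * (10 : ℕ) : ℝ)) <
        1 + 14142135 / 10000000 := by
    rw [abs_of_nonneg (by norm_num)]
    simp only [Finset.sum_range_succ, Finset.sum_range_zero, Nat.factorial, Nat.succ_eq_add_one]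
    norm_num
  have := (abs_sub_le_iff.1 hb).1
  linarith

omit [MeasurableSpace Circle] [BorelSpace Circle] in
/-- `0.88137 < log(1+√2)`. [cite: AizenmanSimon1980RotorIsing, eq. (2) (β_c^R ≥ ln(1+√2) = 0.88)] -/
theorem lt_log_one_add_sqrt_two : (88137 / 100000 : ℝ) < Real.log (1 + Real.sqrt 2) := by
  rw [Real.lt_log_iff_exp_lt (by positivity)]
  exact exp_88137_lt_one_add_sqrt_two

omit [MeasurableSpace Circle] [BorelSpace Circle] in
/-- **`1/log(1+√2) < 1.1346`**: Aizenman–Simon's `k T_c^R/J ≤ 1/ln(1+√2) = 1.1346` (printed `1.13`), outward to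
four decimals. [cite: AizenmanSimon1980RotorIsing, eq. (2)] -/
theorem inv_log_one_add_sqrt_two_lt : 1 / Real.log (1 + Real.sqrt 2) < (11346 / 10000 : ℝ) := by
  have hlogpos : 0 < Real.log (1 + Real.sqrt 2) := by
    rw [log_one_add_sqrt_two_eq_two_mul_criticalBetaTwo]; exact mul_pos two_pos criticalBetaTwo_pos
  rw [div_lt_iff₀ hlogpos]
  nlinarith [lt_log_one_add_sqrt_two]

end PlaneRotator

end Literature.Probability.LatticeModels

end
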